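import Summits.QuantumFields.BalabanUV.Beta.GAN24.LayerPushFrozen

/-!
# `BalabanUV.Beta.GAN24.LayerPushGaugeLeg` — binder row G-an2-4 / (CONV-C), W-slot CT-W, route «WC-TL» ∕ «QR-LL», row **(LT-Δ) «LAYER TRANSPORT»**, part (LT-3b), route (b2) of
# the OWNER gan24-p1 g26's RULING W14 (journal l.40496: «the generic pure-gauge kernel leg against a localised family: frozen term identically zero by telescoping,
# remainder with `sup|dz λ|` as the gradient constant»), file 1 of 2 — ONE KERNEL: a pure-gauge LEFT leg `x ↦ λ(x+e_{κ₁}) − λ x` against a kernel localised at a base point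
# (file 2 = `GAN24/LayerPushGaugeLeft`: the weighted three-leg push)

NOT IN PRINT; OUR BOOKKEEPING ([folklore] summation by parts on `ℤ^{d+1}` + leaf-12's `LatticeFreeze` bricks; G-an2-4 formalisation swarm, leaf prover
`b2b-balaban-gan24-formalise-leaf-01`, gen 63).  HONEST FRAMING (cell contract, verbatim): «discharging `BetaPertH` makes Bałaban's UV stability UNCONDITIONAL — a real constructive-QFT result; it is NOT the
continuum limit and NOT the Clay problem.»  HONEST DEPENDENCY (verbatim): «continuum YM on T⁴ ⇐ BetaPertH ∧ nine spine estimates (0/9 proved); BetaPertH ⇐ (D1) ∧ (D4) ∧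
CAP+tail; G-an2-4 gates asym, D1 and NE2/3/4.»

## What (generic `d`; no object of an2's typed system occurs — the (REP) legs' pure-gauge part `dz λ`, `λ = Psi − bmGaugeAt respStep`
(`ContactKernelCells.legChain_respStepBmSeq_apply_eq_add_dz`), is the intended instance)
§1 `abs_lam_le`, `summable_lam_mul` (a gauge function Lipschitz from `u` against a localised kernel column is summable), **`gaugeLayer_eq`** — SUMMATION BY PARTS IN THE
   KERNEL INDEX over the whole lattice: `Σ_{κ₁} Σ'_x (λ(x+e_{κ₁}) − λ x)·K x z κ₁κ₂ = Σ'_x λ x·Σ_{κ₁} (K (x−e_{κ₁}) z κ₁κ₂ − K x z κ₁κ₂)`; `abs_div_le`, **`tsum_div_eq_zero`**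
   (the backward fibre-divergence of a kernel column has ZERO total — `tsum` shift, NO hypothesis on `K`); **`abs_gaugeLayer_le`**:
   `|Σ_{κ₁} Σ'_x (λ(x+e_{κ₁}) − λ x)·K x z κ₁κ₂| ≤ q·((d+1)(e^{m}+1)·B)·M₁·e^{−m‖z−u‖₁}` with `q` = the Lipschitz allowance of `λ` from `u` = the SUP of the gauge leg seen from `u`
   — the frozen term `λ(u)·Σ'_x div K` is ZERO IDENTICALLY; the size of `λ` itself never enters.
§2 **`abs_gaugeSand_le`** — the two-leg sandwich with a pure-gauge LEFT leg and a right leg at sup `pr`: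
   `≤ (d+1)²·(e^{m}+1)·q·pr·B·M₁·Zl(m−κ)` — NO frozen term, NO charge hypothesis.
[folklore]; 0 cited facts, 0 `def`, 0 `def … : Prop`, 0 sorry.  Asserts NOTHING about the size of `dz λ` for the dressed legs (the located item (LT-3b-env) ∕ the seams,
journal R-leaf01-g63-5); NEVER «G-an2-4 closed» as (CONV-C); NOT D1, NOT `BetaPertH`, NOT continuum, NOT Clay.  2026-08-22.
-/

noncomputable section

open Finset
open scoped BigOperators
open Literature.MathematicalPhysics.QuantumFieldTheory
open Literature.MathematicalPhysics.QuantumFieldTheory.Balaban1983to89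
open Literature.MathematicalPhysics.QuantumFieldTheory.Balaban1983to89.Beta
open B12Sec2to5 (l1 l1_nonneg)
open ExpKernelCalculus (MKer Decays comp Zl Zl_nonneg Zl_pos summable_exp_shift summable_exp_shift' tsum_exp_shift' l1_sub_triangle l1_sub_symm)
open OneStepResolventKernel (Fib)
open KKTFluctuationEnergy (tsum_shift tsum_shift_sub)
open Summit.QuantumFields.BalabanUV.Beta.GAN24.LatticeFreeze (summable_mul_of_env abs_tsum_mul_le_of_env mul_exp_neg_le abs_tsum_mul_sub_frozen_le
  abs_sub_le_of_unit_steps)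
open Summit.QuantumFields.BalabanUV.Beta.GAN24.LayerPushEntry (abs_tsum_le_tsum_of_abs_le exp_three_le)
open LatticeForm (quo)
open Summit.QuantumFields.BalabanUV.Beta.GAN24.Push4 (vertexW vertexW_apply Lk Rk ffRead)
open Summit.QuantumFields.BalabanUV.Beta.GAN24.Push3 (push₃)
open Summit.QuantumFields.BalabanUV.Beta.GAN24.Push4TwoRate (summable_leg)
open Summit.QuantumFields.BalabanUV.Beta.GAN24.LayerPushFrozenSlice (exp_wobble leg_rel_sup)
open Summit.QuantumFields.BalabanUV.Beta.GAN24.LayerPushFrozen (sand_inl_inl push₃_eq_vertexW_sand)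

namespace Summit.QuantumFields.BalabanUV.Beta.GAN24.LayerPushGaugeLeg

variable {d : ℕ}

/-! ## §1 A pure-gauge leg in a KERNEL index: summation by parts over the whole lattice, then the frozen term vanishes identically -/

section GaugeLayer

variable {lam : (Fin (d + 1) → ℤ) → ℝ} {K : MKer (d + 1) (Fib d)} {u : Fin (d + 1) → ℤ} {B m κ q Λ : ℝ}
  (hm : κ < m) (hκ : 0 ≤ κ) (hB : 0 ≤ B) (hq : 0 ≤ q) (hΛ : 0 ≤ Λ)
  (hK : ∀ x z κ₁ κ₂, |K x z (Sum.inl κ₁) (Sum.inl κ₂)| ≤ B * Real.exp (-m * (l1 (x - u) + l1 (z - u))))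
  (hlam0 : |lam u| ≤ Λ)
  (hlam : ∀ x, |lam x - lam u| ≤ q * l1 (x - u) * Real.exp (κ * l1 (x - u)))

include hΛ hlam0 hlam in
/-- [folklore] The gauge function grows at most linearly-exponentially from the base point: `|λ x| ≤ (Λ + q)·(1 + ‖x−u‖₁)·e^{κ‖x−u‖₁}` — crude, for summability only. -/
theorem abs_lam_le (hκ : 0 ≤ κ) (x : Fin (d + 1) → ℤ) : |lam x| ≤ (Λ + q * l1 (x - u)) * Real.exp (κ * l1 (x - u)) := by
  have h1 : |lam x| ≤ |lam u| + |lam x - lam u| := by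
    have := abs_add_le (lam u) (lam x - lam u); simpa using this
  have he : 1 ≤ Real.exp (κ * l1 (x - u)) := by
    have := Real.exp_le_exp.2 (show (0:ℝ) ≤ κ * l1 (x - u) by nlinarith [l1_nonneg (x - u)]); rwa [Real.exp_zero] at this
  have hΛe : Λ ≤ Λ * Real.exp (κ * l1 (x - u)) := by nlinarith [mul_le_mul_of_nonneg_left he hΛ]
  calc |lam x| ≤ Λ + q * l1 (x - u) * Real.exp (κ * l1 (x - u)) := h1.trans (add_le_add hlam0 (hlam x))
    _ ≤ Λ * Real.exp (κ * l1 (x - u)) + q * l1 (x - u) * Real.exp (κ * l1 (x - u)) := by linarith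
    _ = (Λ + q * l1 (x - u)) * Real.exp (κ * l1 (x - u)) := by ring

include hm hκ hB hq hΛ hK hlam0 hlam in
/-- [folklore] The gauge function against one kernel column is absolutely summable (any shift `v` of the column's argument). -/
theorem summable_lam_mul (z v : Fin (d + 1) → ℤ) (κ₁ κ₂ : Fin (d + 1)) :
    Summable fun x => lam x * K (x + v) z (Sum.inl κ₁) (Sum.inl κ₂) := by
  -- majorant: (Λ + q l1)·e^{κ l1(x−u)} · B e^{m‖v‖} e^{−m l1(x−u)} ≤ const · (1 + l1) e^{−(m−κ) l1} ≤ const' e^{−((m−κ)/2) l1}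
  have hmk : 0 < m - κ := sub_pos.2 hm
  have hv : ∀ x, l1 (x - u) ≤ l1 (x + v - u) + l1 v := fun x => by
    have t := l1_sub_triangle x (x + v) u
    have e1 : l1 (x - (x + v)) = l1 v := by rw [l1_sub_symm, add_sub_cancel_left]
    linarith
  refine Summable.of_norm_bounded ((summable_exp_shift' (half_pos hmk) u).mul_left
    ((Λ + q * (2 / (m - κ))) * (B * Real.exp (m * l1 v)))) fun x => ?_
  rw [Real.norm_eq_abs, abs_mul]
  have hKx : |K (x + v) z (Sum.inl κ₁) (Sum.inl κ₂)| ≤ B * Real.exp (m * l1 v) * Real.exp (-m * l1 (x - u)) := by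
    refine (hK (x + v) z κ₁ κ₂).trans ?_
    rw [mul_assoc, ← Real.exp_add]
    refine mul_le_mul_of_nonneg_left (Real.exp_le_exp.2 ?_) hB
    have hm0 : 0 ≤ m := hκ.trans hm.le
    nlinarith [hv x, l1_nonneg (z - u), l1_nonneg (x + v - u)]
  have hl := abs_lam_le hΛ hlam0 hlam hκ x
  have hme := mul_exp_neg_le hmk (l1 (x - u))
  have hexp : Real.exp (κ * l1 (x - u)) * Real.exp (-m * l1 (x - u)) = Real.exp (-(m - κ) * l1 (x - u)) := by
    rw [← Real.exp_add]; congr 1; ring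
  have hhalf : Real.exp (-(m - κ) * l1 (x - u)) ≤ Real.exp (-((m - κ) / 2) * l1 (x - u)) :=
    Real.exp_le_exp.2 (by nlinarith [l1_nonneg (x - u)])
  calc |lam x| * |K (x + v) z (Sum.inl κ₁) (Sum.inl κ₂)|
      ≤ ((Λ + q * l1 (x - u)) * Real.exp (κ * l1 (x - u))) * (B * Real.exp (m * l1 v) * Real.exp (-m * l1 (x - u))) :=
        mul_le_mul hl hKx (abs_nonneg _) (by have := l1_nonneg (x - u); positivity)
    _ = (B * Real.exp (m * l1 v)) * (Λ * Real.exp (-(m - κ) * l1 (x - u)) + q * (l1 (x - u) * Real.exp (-(m - κ) * l1 (x - u)))) := by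
        rw [← hexp]; ring
    _ ≤ (B * Real.exp (m * l1 v)) * (Λ * Real.exp (-((m - κ) / 2) * l1 (x - u)) + q * (2 / (m - κ) * Real.exp (-((m - κ) / 2) * l1 (x - u)))) := by
        refine mul_le_mul_of_nonneg_left (add_le_add (mul_le_mul_of_nonneg_left hhalf hΛ) (mul_le_mul_of_nonneg_left hme hq)) (by positivity)
    _ = (Λ + q * (2 / (m - κ))) * (B * Real.exp (m * l1 v)) * Real.exp (-((m - κ) / 2) * l1 (x - u)) := by ring

include hm hκ hB hq hΛ hK hlam0 hlam in
/-- NOT IN PRINT; OUR BOOKKEEPING.  **SUMMATION BY PARTS IN THE KERNEL INDEX, NO BOUNDARY**: a pure-gauge LEFT leg `x ↦ λ(x + e_{κ₁}) − λ x` against the kernel reads the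
gauge FUNCTION against the kernel's backward fibre-divergence:
`Σ_{κ₁} Σ'_x (λ(x+e_{κ₁}) − λ x)·K x z κ₁ κ₂ = Σ'_x λ x·Σ_{κ₁} (K (x − e_{κ₁}) z κ₁ κ₂ − K x z κ₁ κ₂)` (`tsum` shift over `ℤ^{d+1}`). -/
theorem gaugeLayer_eq (z : Fin (d + 1) → ℤ) (κ₂ : Fin (d + 1)) :
    ∑ κ₁ : Fin (d + 1), ∑' x : Fin (d + 1) → ℤ, (lam (x + Pi.single κ₁ (1 : ℤ)) - lam x) * K x z (Sum.inl κ₁) (Sum.inl κ₂)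
      = ∑' x : Fin (d + 1) → ℤ, lam x * ∑ κ₁ : Fin (d + 1), (K (x - Pi.single κ₁ (1 : ℤ)) z (Sum.inl κ₁) (Sum.inl κ₂) - K x z (Sum.inl κ₁) (Sum.inl κ₂)) := by
  have hs0 : ∀ κ₁, Summable fun x => lam x * K x z (Sum.inl κ₁) (Sum.inl κ₂) := fun κ₁ => by
    simpa using summable_lam_mul hm hκ hB hq hΛ hK hlam0 hlam z 0 κ₁ κ₂
  have hs1 : ∀ κ₁, Summable fun x => lam x * K (x - Pi.single κ₁ (1 : ℤ)) z (Sum.inl κ₁) (Sum.inl κ₂) := fun κ₁ => by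
    simpa [sub_eq_add_neg] using summable_lam_mul hm hκ hB hq hΛ hK hlam0 hlam z (-Pi.single κ₁ (1 : ℤ)) κ₁ κ₂
  have hs2 : ∀ κ₁, Summable fun x => lam (x + Pi.single κ₁ (1 : ℤ)) * K x z (Sum.inl κ₁) (Sum.inl κ₂) := fun κ₁ => by
    have h := (Equiv.addRight (Pi.single κ₁ (1 : ℤ))).summable_iff.mpr (hs1 κ₁)
    refine h.congr fun x => ?_
    show lam (x + Pi.single κ₁ (1 : ℤ)) * K (x + Pi.single κ₁ (1 : ℤ) - Pi.single κ₁ (1 : ℤ)) z (Sum.inl κ₁) (Sum.inl κ₂) = _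
    rw [add_sub_cancel_right]
  have hterm : ∀ κ₁, (∑' x : Fin (d + 1) → ℤ, (lam (x + Pi.single κ₁ (1 : ℤ)) - lam x) * K x z (Sum.inl κ₁) (Sum.inl κ₂))
      = ∑' x : Fin (d + 1) → ℤ, lam x * (K (x - Pi.single κ₁ (1 : ℤ)) z (Sum.inl κ₁) (Sum.inl κ₂) - K x z (Sum.inl κ₁) (Sum.inl κ₂)) := by
    intro κ₁
    have e1 : (∑' x : Fin (d + 1) → ℤ, (lam (x + Pi.single κ₁ (1 : ℤ)) - lam x) * K x z (Sum.inl κ₁) (Sum.inl κ₂))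
        = (∑' x : Fin (d + 1) → ℤ, lam (x + Pi.single κ₁ (1 : ℤ)) * K x z (Sum.inl κ₁) (Sum.inl κ₂)) - ∑' x : Fin (d + 1) → ℤ, lam x * K x z (Sum.inl κ₁) (Sum.inl κ₂) := by
      rw [← (hs2 κ₁).tsum_sub (hs0 κ₁)]; exact tsum_congr fun x => by ring
    have e2 : (∑' x : Fin (d + 1) → ℤ, lam (x + Pi.single κ₁ (1 : ℤ)) * K x z (Sum.inl κ₁) (Sum.inl κ₂))
        = ∑' x : Fin (d + 1) → ℤ, lam x * K (x - Pi.single κ₁ (1 : ℤ)) z (Sum.inl κ₁) (Sum.inl κ₂) := by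
      have h := (Equiv.addRight (Pi.single κ₁ (1 : ℤ))).tsum_eq (fun y => lam y * K (y - Pi.single κ₁ (1 : ℤ)) z (Sum.inl κ₁) (Sum.inl κ₂))
      refine Eq.trans (tsum_congr fun x => ?_) h
      show _ = lam (x + Pi.single κ₁ (1 : ℤ)) * K (x + Pi.single κ₁ (1 : ℤ) - Pi.single κ₁ (1 : ℤ)) z (Sum.inl κ₁) (Sum.inl κ₂)
      rw [add_sub_cancel_right]
    have e3 : (∑' x : Fin (d + 1) → ℤ, lam x * (K (x - Pi.single κ₁ (1 : ℤ)) z (Sum.inl κ₁) (Sum.inl κ₂) - K x z (Sum.inl κ₁) (Sum.inl κ₂)))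
        = (∑' x : Fin (d + 1) → ℤ, lam x * K (x - Pi.single κ₁ (1 : ℤ)) z (Sum.inl κ₁) (Sum.inl κ₂)) - ∑' x : Fin (d + 1) → ℤ, lam x * K x z (Sum.inl κ₁) (Sum.inl κ₂) := by
      rw [← (hs1 κ₁).tsum_sub (hs0 κ₁)]; exact tsum_congr fun x => by ring
    rw [e1, e2, e3]
  rw [Finset.sum_congr rfl fun κ₁ _ => hterm κ₁]
  rw [← Summable.tsum_finsetSum (fun κ₁ _ => ((hs1 κ₁).sub (hs0 κ₁)).congr (fun x => by ring))]
  exact tsum_congr fun x => by rw [Finset.mul_sum]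

include hB hK in
/-- [folklore] The backward fibre-divergence of the kernel column is localised like the kernel (one unit shift costs `e^{m}`):
`|Σ_{κ₁} (K (x−e_{κ₁}) z κ₁ κ₂ − K x z κ₁ κ₂)| ≤ (d+1)(e^{m}+1)·B·e^{−m‖z−u‖₁}·e^{−m‖x−u‖₁}`. -/
theorem abs_div_le (hm0 : 0 ≤ m) (x z : Fin (d + 1) → ℤ) (κ₂ : Fin (d + 1)) :
    |∑ κ₁ : Fin (d + 1), (K (x - Pi.single κ₁ (1 : ℤ)) z (Sum.inl κ₁) (Sum.inl κ₂) - K x z (Sum.inl κ₁) (Sum.inl κ₂))|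
      ≤ (((d : ℝ) + 1) * (Real.exp m + 1) * B * Real.exp (-m * l1 (z - u))) * Real.exp (-m * l1 (x - u)) := by
  have hstep : ∀ κ₁ : Fin (d + 1), l1 (x - u) ≤ l1 (x - Pi.single κ₁ (1 : ℤ) - u) + 1 := by
    intro κ₁
    have t := l1_sub_triangle x (x - Pi.single κ₁ (1 : ℤ)) u
    have e1 : l1 (x - (x - Pi.single κ₁ (1 : ℤ))) = 1 := by
      rw [sub_sub_cancel]
      unfold l1
      rw [Finset.sum_eq_single κ₁]
      · simp
      · intro b _ hb; simp [hb]
      · intro h; exact absurd (Finset.mem_univ κ₁) h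
    linarith
  have hterm : ∀ κ₁ : Fin (d + 1), |K (x - Pi.single κ₁ (1 : ℤ)) z (Sum.inl κ₁) (Sum.inl κ₂) - K x z (Sum.inl κ₁) (Sum.inl κ₂)|
      ≤ (Real.exp m + 1) * B * Real.exp (-m * l1 (z - u)) * Real.exp (-m * l1 (x - u)) := by
    intro κ₁
    have h1 := hK (x - Pi.single κ₁ (1 : ℤ)) z κ₁ κ₂
    have h2 := hK x z κ₁ κ₂
    have e1 : Real.exp (-m * (l1 (x - Pi.single κ₁ (1 : ℤ) - u) + l1 (z - u))) ≤ Real.exp m * (Real.exp (-m * l1 (z - u)) * Real.exp (-m * l1 (x - u))) := by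
      rw [← Real.exp_add, ← Real.exp_add]; exact Real.exp_le_exp.2 (by nlinarith [hstep κ₁])
    have e2 : Real.exp (-m * (l1 (x - u) + l1 (z - u))) = Real.exp (-m * l1 (z - u)) * Real.exp (-m * l1 (x - u)) := by
      rw [← Real.exp_add]; congr 1; ring
    calc |K (x - Pi.single κ₁ (1 : ℤ)) z (Sum.inl κ₁) (Sum.inl κ₂) - K x z (Sum.inl κ₁) (Sum.inl κ₂)|
        ≤ |K (x - Pi.single κ₁ (1 : ℤ)) z (Sum.inl κ₁) (Sum.inl κ₂)| + |K x z (Sum.inl κ₁) (Sum.inl κ₂)| := abs_sub _ _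
      _ ≤ B * (Real.exp m * (Real.exp (-m * l1 (z - u)) * Real.exp (-m * l1 (x - u))))
          + B * (Real.exp (-m * l1 (z - u)) * Real.exp (-m * l1 (x - u))) :=
          add_le_add (h1.trans (mul_le_mul_of_nonneg_left e1 hB)) (h2.trans (le_of_eq (by rw [e2])))
      _ = _ := by ring
  calc _ ≤ ∑ κ₁ : Fin (d + 1), |K (x - Pi.single κ₁ (1 : ℤ)) z (Sum.inl κ₁) (Sum.inl κ₂) - K x z (Sum.inl κ₁) (Sum.inl κ₂)| :=
        Finset.abs_sum_le_sum_abs _ _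
    _ ≤ ∑ _κ₁ : Fin (d + 1), (Real.exp m + 1) * B * Real.exp (-m * l1 (z - u)) * Real.exp (-m * l1 (x - u)) := Finset.sum_le_sum fun κ₁ _ => hterm κ₁
    _ = _ := by rw [Finset.sum_const, Finset.card_univ, Fintype.card_fin, nsmul_eq_mul]; push_cast; ring

include hB hK in
/-- [folklore] The backward fibre-divergence of a kernel column has ZERO TOTAL over the lattice (`tsum` shift), for every `z, κ₂`. -/
theorem tsum_div_eq_zero (hm0 : 0 < m) (z : Fin (d + 1) → ℤ) (κ₂ : Fin (d + 1)) :
    ∑' x : Fin (d + 1) → ℤ, ∑ κ₁ : Fin (d + 1), (K (x - Pi.single κ₁ (1 : ℤ)) z (Sum.inl κ₁) (Sum.inl κ₂) - K x z (Sum.inl κ₁) (Sum.inl κ₂)) = 0 := by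
  have hs0 : ∀ κ₁, Summable fun x => K x z (Sum.inl κ₁) (Sum.inl κ₂) := by
    intro κ₁
    refine Summable.of_norm_bounded ((summable_exp_shift' hm0 u).mul_left (B * Real.exp (-m * l1 (z - u)))) fun x => ?_
    rw [Real.norm_eq_abs]
    refine (hK x z κ₁ κ₂).trans (le_of_eq ?_)
    rw [mul_add, Real.exp_add]; ring
  have hs1 : ∀ κ₁, Summable fun x : Fin (d + 1) → ℤ => K (x - Pi.single κ₁ (1 : ℤ)) z (Sum.inl κ₁) (Sum.inl κ₂) := by
    intro κ₁
    refine Summable.of_norm_bounded ((summable_exp_shift' hm0 u).mul_left (B * Real.exp m * Real.exp (-m * l1 (z - u)))) fun x => ?_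
    rw [Real.norm_eq_abs]
    have hstep : l1 (x - u) ≤ l1 (x - Pi.single κ₁ (1 : ℤ) - u) + 1 := by
      have t := l1_sub_triangle x (x - Pi.single κ₁ (1 : ℤ)) u
      have e1 : l1 (x - (x - Pi.single κ₁ (1 : ℤ))) = 1 := by
        rw [sub_sub_cancel]
        unfold l1
        rw [Finset.sum_eq_single κ₁]
        · simp
        · intro b _ hb; simp [hb]
        · intro h; exact absurd (Finset.mem_univ κ₁) h
      linarith
    refine (hK (x - Pi.single κ₁ (1 : ℤ)) z κ₁ κ₂).trans ?_
    rw [mul_assoc (B * Real.exp m), ← Real.exp_add, mul_assoc B, ← Real.exp_add]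
    exact mul_le_mul_of_nonneg_left (Real.exp_le_exp.2 (by nlinarith [l1_nonneg (z - u)])) hB
  rw [Summable.tsum_finsetSum (fun κ₁ _ => (hs1 κ₁).sub (hs0 κ₁))]
  refine Finset.sum_eq_zero fun κ₁ _ => ?_
  have hsh : ∑' x : Fin (d + 1) → ℤ, K (x - Pi.single κ₁ (1 : ℤ)) z (Sum.inl κ₁) (Sum.inl κ₂) = ∑' x : Fin (d + 1) → ℤ, K x z (Sum.inl κ₁) (Sum.inl κ₂) :=
    tsum_shift_sub (fun y => K y z (Sum.inl κ₁) (Sum.inl κ₂)) (Pi.single κ₁ (1 : ℤ))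
  rw [(hs1 κ₁).tsum_sub (hs0 κ₁), hsh, sub_self]

include hm hκ hB hq hΛ hK hlam0 hlam in
/-- NOT IN PRINT; OUR BOOKKEEPING ([folklore] §1's identity, the zero total of the divergence, and leaf-12's frozen-leg remainder `LatticeFreeze.abs_tsum_mul_sub_frozen_le`).
**THE `x`-LAYER OF A PURE-GAUGE LEFT LEG HAS NO FROZEN TERM**: with `|λ x − λ u| ≤ q·‖x−u‖₁·e^{κ‖x−u‖₁}` (the Lipschitz allowance of the gauge function = the SUP of the
gauge leg `dz λ` seen from `u`, `LatticeFreeze.abs_sub_le_of_unit_steps`) and `|K x z κ₁ κ₂| ≤ B·e^{−m(‖x−u‖₁+‖z−u‖₁)}`, `0 ≤ κ < m`,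
`|Σ_{κ₁} Σ'_x (λ(x+e_{κ₁}) − λ x)·K x z κ₁ κ₂| ≤ q·((d+1)(e^{m}+1)·B)·M₁·e^{−m‖z−u‖₁}`, `M₁ = (2∕(m−κ))·Zl((m−κ)∕2)` — the term `λ(u)·Σ'_x div K = 0` drops
IDENTICALLY (no charge hypothesis on `K`); what remains carries the gauge leg's sup `q` in the place of a Lipschitz allowance (compare
`LayerPushFrozenSlice.abs_xlayer_sub_frozen_le`). -/
theorem abs_gaugeLayer_le (z : Fin (d + 1) → ℤ) (κ₂ : Fin (d + 1)) :
    |∑ κ₁ : Fin (d + 1), ∑' x : Fin (d + 1) → ℤ, (lam (x + Pi.single κ₁ (1 : ℤ)) - lam x) * K x z (Sum.inl κ₁) (Sum.inl κ₂)|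
      ≤ q * (((d : ℝ) + 1) * (Real.exp m + 1) * B * Real.exp (-m * l1 (z - u))) * (2 / (m - κ) * Zl (d + 1) ((m - κ) / 2)) := by
  have hm0 : 0 < m := hκ.trans_lt hm
  rw [gaugeLayer_eq hm hκ hB hq hΛ hK hlam0 hlam z κ₂]
  set D : (Fin (d + 1) → ℤ) → ℝ := fun x =>
    ∑ κ₁ : Fin (d + 1), (K (x - Pi.single κ₁ (1 : ℤ)) z (Sum.inl κ₁) (Sum.inl κ₂) - K x z (Sum.inl κ₁) (Sum.inl κ₂)) with hD
  have hDle : ∀ x, |D x| ≤ (((d : ℝ) + 1) * (Real.exp m + 1) * B * Real.exp (-m * l1 (z - u))) * Real.exp (-m * l1 (x - u)) :=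
    fun x => abs_div_le hB hK hm0.le x z κ₂
  have hD0 : ∑' x : Fin (d + 1) → ℤ, D x = 0 := tsum_div_eq_zero hB hK hm0 z κ₂
  -- summability of `λ·D` (finite sum of shifted columns)
  have hsum : Summable fun x => lam x * D x := by
    have h1 : ∀ κ₁, Summable fun x => lam x * K (x - Pi.single κ₁ (1 : ℤ)) z (Sum.inl κ₁) (Sum.inl κ₂) := fun κ₁ => by
      simpa [sub_eq_add_neg] using summable_lam_mul hm hκ hB hq hΛ hK hlam0 hlam z (-Pi.single κ₁ (1 : ℤ)) κ₁ κ₂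
    have h0 : ∀ κ₁, Summable fun x => lam x * K x z (Sum.inl κ₁) (Sum.inl κ₂) := fun κ₁ => by
      simpa using summable_lam_mul hm hκ hB hq hΛ hK hlam0 hlam z 0 κ₁ κ₂
    have := summable_sum (s := (Finset.univ : Finset (Fin (d + 1)))) fun κ₁ _ => (h1 κ₁).sub (h0 κ₁)
    refine this.congr fun x => ?_
    rw [hD]; simp only [Finset.mul_sum, mul_sub]
  have h := abs_tsum_mul_sub_frozen_le (w := lam) (φ := D) (u := u) hm hκ hq zero_le_one
    (fun x => by rw [mul_one]; exact hlam x) hDle hsum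
  rw [hD0, mul_zero, sub_zero, mul_one] at h
  exact h

end GaugeLayer

/-! ## §2 The two-leg sandwich with a pure-gauge LEFT leg: no frozen term; the gauge leg's sup sits in the Lipschitz slot -/

section GaugeSandwich

variable {lam : (Fin (d + 1) → ℤ) → ℝ} {rz : Fin (d + 1) → (Fin (d + 1) → ℤ) → ℝ} {K : MKer (d + 1) (Fib d)} {u : Fin (d + 1) → ℤ}
  {B m κ q Λ pr : ℝ}
  (hm : κ < m) (hκ : 0 ≤ κ) (hB : 0 ≤ B) (hq : 0 ≤ q) (hΛ : 0 ≤ Λ) (hpr : 0 ≤ pr)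
  (hK : ∀ x z κ₁ κ₂, |K x z (Sum.inl κ₁) (Sum.inl κ₂)| ≤ B * Real.exp (-m * (l1 (x - u) + l1 (z - u))))
  (hlam0 : |lam u| ≤ Λ)
  (hlam : ∀ x, |lam x - lam u| ≤ q * l1 (x - u) * Real.exp (κ * l1 (x - u)))
  (hr : ∀ κ₂ z, |rz κ₂ z| ≤ pr * Real.exp (κ * l1 (z - u)))

include hm hκ hB hq hΛ hpr hK hlam0 hlam hr in
/-- NOT IN PRINT; OUR BOOKKEEPING.  **THE SANDWICH WITH A PURE-GAUGE LEFT LEG**: `|Σ'_z Σ_{κ₂} (Σ'_x Σ_{κ₁} (λ(x+e_{κ₁}) − λ x)·K x z κ₁κ₂)·rz κ₂ z|`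
`≤ (d+1)²·(e^{m}+1)·q·pr·B·M₁·Zl(m−κ)` — NO frozen term at all (§1), ONE factor `q` = the gauge leg's sup, the right leg at its sup `pr`. -/
theorem abs_gaugeSand_le :
    |∑' z : Fin (d + 1) → ℤ, ∑ κ₂ : Fin (d + 1),
        (∑' x : Fin (d + 1) → ℤ, ∑ κ₁ : Fin (d + 1), (lam (x + Pi.single κ₁ (1 : ℤ)) - lam x) * K x z (Sum.inl κ₁) (Sum.inl κ₂)) * rz κ₂ z|
      ≤ ((d : ℝ) + 1) ^ 2 * (Real.exp m + 1) * q * pr * B * (2 / (m - κ) * Zl (d + 1) ((m - κ) / 2)) * Zl (d + 1) (m - κ) := by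
  have hm0 : 0 < m := hκ.trans_lt hm
  have hmk : 0 < m - κ := sub_pos.2 hm
  have hM₁ : 0 ≤ 2 / (m - κ) * Zl (d + 1) ((m - κ) / 2) := by have := Zl_nonneg (D := d + 1) (half_pos hmk); positivity
  -- the x-layer in the `Σ_{κ₁} Σ'_x` order and its bound
  set G : (Fin (d + 1) → ℤ) → Fin (d + 1) → ℝ := fun z κ₂ =>
    ∑ κ₁ : Fin (d + 1), ∑' x : Fin (d + 1) → ℤ, (lam (x + Pi.single κ₁ (1 : ℤ)) - lam x) * K x z (Sum.inl κ₁) (Sum.inl κ₂) with hG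
  set BG : ℝ := q * (((d : ℝ) + 1) * (Real.exp m + 1) * B) * (2 / (m - κ) * Zl (d + 1) ((m - κ) / 2)) with hBG
  have hBG0 : 0 ≤ BG := by rw [hBG]; positivity
  have hGle : ∀ z κ₂, |G z κ₂| ≤ BG * Real.exp (-m * l1 (z - u)) := by
    intro z κ₂
    have h := abs_gaugeLayer_le hm hκ hB hq hΛ hK hlam0 hlam z κ₂
    rw [hG, hBG]
    refine h.trans (le_of_eq ?_); ring
  -- summability of each `κ₁`-term in `x` (for the interchange)
  have hsx : ∀ z κ₁ κ₂, Summable fun x : Fin (d + 1) → ℤ => (lam (x + Pi.single κ₁ (1 : ℤ)) - lam x) * K x z (Sum.inl κ₁) (Sum.inl κ₂) := by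
    intro z κ₁ κ₂
    have h0 : Summable fun x : Fin (d + 1) → ℤ => lam x * K x z (Sum.inl κ₁) (Sum.inl κ₂) := by
      simpa using summable_lam_mul hm hκ hB hq hΛ hK hlam0 hlam z 0 κ₁ κ₂
    have h1 : Summable fun x : Fin (d + 1) → ℤ => lam x * K (x - Pi.single κ₁ (1 : ℤ)) z (Sum.inl κ₁) (Sum.inl κ₂) := by
      simpa [sub_eq_add_neg] using summable_lam_mul hm hκ hB hq hΛ hK hlam0 hlam z (-Pi.single κ₁ 1) κ₁ κ₂
    have h2 : Summable fun x : Fin (d + 1) → ℤ => lam (x + Pi.single κ₁ (1 : ℤ)) * K x z (Sum.inl κ₁) (Sum.inl κ₂) := by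
      have h := (Equiv.addRight (Pi.single κ₁ (1 : ℤ))).summable_iff.mpr h1
      refine h.congr fun x => ?_
      show lam (x + Pi.single κ₁ 1) * K (x + Pi.single κ₁ 1 - Pi.single κ₁ 1) z (Sum.inl κ₁) (Sum.inl κ₂) = _
      rw [add_sub_cancel_right]
    exact (h2.sub h0).congr fun x => by ring
  have hx : ∀ z κ₂, (∑' x : Fin (d + 1) → ℤ, ∑ κ₁ : Fin (d + 1), (lam (x + Pi.single κ₁ (1 : ℤ)) - lam x) * K x z (Sum.inl κ₁) (Sum.inl κ₂)) = G z κ₂ := by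
    intro z κ₂
    rw [hG]
    exact Summable.tsum_finsetSum fun κ₁ _ => hsx z κ₁ κ₂
  -- the z-series: finite sum over κ₂ outside, right leg against the layer envelope
  have hzs : ∀ κ₂, Summable fun z => rz κ₂ z * G z κ₂ := fun κ₂ =>
    summable_mul_of_env (u := u) hm hpr zero_le_one (fun z => by rw [mul_one]; exact hr κ₂ z) (hGle · κ₂)
  have hzb : ∀ κ₂, |∑' z, rz κ₂ z * G z κ₂| ≤ pr * 1 * BG * Zl (d + 1) (m - κ) := fun κ₂ =>
    abs_tsum_mul_le_of_env (u := u) hm hpr zero_le_one (fun z => by rw [mul_one]; exact hr κ₂ z) (hGle · κ₂)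
  have e : ∀ z, (∑ κ₂ : Fin (d + 1), (∑' x : Fin (d + 1) → ℤ, ∑ κ₁ : Fin (d + 1),
      (lam (x + Pi.single κ₁ (1 : ℤ)) - lam x) * K x z (Sum.inl κ₁) (Sum.inl κ₂)) * rz κ₂ z)
      = ∑ κ₂ : Fin (d + 1), rz κ₂ z * G z κ₂ := fun z => Finset.sum_congr rfl fun κ₂ _ => by rw [hx z κ₂, mul_comm]
  rw [tsum_congr e, Summable.tsum_finsetSum fun κ₂ _ => hzs κ₂]
  calc |∑ κ₂ : Fin (d + 1), ∑' z, rz κ₂ z * G z κ₂| ≤ ∑ κ₂ : Fin (d + 1), |∑' z, rz κ₂ z * G z κ₂| := Finset.abs_sum_le_sum_abs _ _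
    _ ≤ ∑ _κ₂ : Fin (d + 1), pr * 1 * BG * Zl (d + 1) (m - κ) := Finset.sum_le_sum fun κ₂ _ => hzb κ₂
    _ = _ := by
        simp only [Finset.sum_const, Finset.card_univ, Fintype.card_fin, nsmul_eq_mul, hBG]
        push_cast
        ring

end GaugeSandwich

end Summit.QuantumFields.BalabanUV.Beta.GAN24.LayerPushGaugeLeg

end
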